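import Literature.MathematicalPhysics.QuantumLattice.SectorisedIncrementBoundBinomialWeightedPlateau
import Literature.MathematicalPhysics.QuantumLattice.SectorisedIncrementBoundBinomialWeightedPrescribedPlateauSubLaplacian
import HarnessLib

/-!
# The FIRST ORDER of the sectorised single-scale increment MINUS ITS ONE-LINE TERM (`e^{Δ_C}G − G − Δ_C G`), binomial–Gram form, DECAY-WEIGHTED, one pinned leg
# (no prescription), plateau transport

Topic `MathematicalPhysics/QuantumLattice`; the non-prescribed companion of `SectorisedIncrementBoundBinomialWeightedPrescribedPlateauSubLaplacian` and the minus-one-line twin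
of `SectorisedIncrementBoundBinomialWeightedPlateau` (Benfatto–Giuliani–Mastropietro 2006 (2.61)–(2.63), (2.66) at first order, (2.86)–(2.90), §3 (3.2)–(3.8)): the piece
«at least two self-lines» of one Gaussian step, bounded by the same binomial–Gram sum over the input degrees `2m′ ≥ 2p + 4` only — read through `(f, g)` and transported
to the Hubbard torus by the plateau machinery (`map_sectorAnalysis_grassmannLaplacian_map_sectorPreimage_of_plateau`).

* §0 **`sum_wt_norm_kernel_gaussConv_sub_sub_laplacian_le_binomial_of_gramBounded_wt`** (generic labels, no prescription; the `J = ∅` case of the prescribed lemma):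
  `Σ_{W_i = w} wt(W)·‖kernel_{2p}(e^{Δ_C}H − H − Δ_C H)(W)‖ ≤ Σ_{m′ > p+1} C(2m′,2p)·κ^{2m′−2p}·N(m′)`;
* §1 **`sum_wt_norm_kernel_map_gaussConv_sub_sub_laplacian_le_binomial_of_gramBounded`** (read through `(f, g)`);
* §2 **`sum_wt_norm_sectorAnalysis_gaussConv_sub_sub_laplacian_le_binomial_of_plateau`** (Hubbard torus).

Use (cell gate-hubbard-kl, K3 engine child, E1 interface (E2) in-tower route / located risk #17): the one-pinned-leg degree-`Dw` born sizes of a tower increment WITHOUT the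
block tadpole (rate-decoupled carrier `klWtPinnedSumPow`).  Everything is proved; no definition, no named fact.

## Sources

G. Benfatto, A. Giuliani, V. Mastropietro, Ann. Henri Poincaré 7 (2006) 809–898, (2.61)–(2.63), (2.66), (2.70)–(2.71a), (2.86)–(2.90), §2.8 (2.76)–(2.84), §3 (3.2)–(3.8)
[`BenfattoGiulianiMastropietro2006`]; K. Gawȩdzki, A. Kupiainen, Comm. Math. Phys. 102 (1985) 1–30, §3 [`GawedzkiKupiainen1985GrossNeveu`].
-/

noncomputable section

namespace Literature.MathematicalPhysics.QuantumLattice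

open GrassmannAlgebra Finset Literature.Probability.LatticeModels Literature.Probability.LatticeModels.BattleFederbush
open scoped Nat

universe u

/-! ### §0 Generic labels, no prescription -/

section Abstract

variable {𝕜 : Type*} [RCLike 𝕜] {Γ : Type u} [Fintype Γ] [DecidableEq Γ] {wt : Finset Γ → ℝ}

/-- `(2p)!⁻¹ · Π_{j < 2p} (2m′ − j) = C(2m′, 2p)` (cast to `ℝ`). [folklore] -/
private theorem factorial_inv_mul_prod_sub_eq_choose₂ (p m' : ℕ) :
    (((2 * p).factorial : ℝ))⁻¹ * ((∏ j : Fin (2 * p), (2 * m' - (j : ℕ)) : ℕ) : ℝ) = ((2 * m').choose (2 * p) : ℝ) := by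
  have hfac : ((2 * p).factorial : ℝ) ≠ 0 := by positivity
  rw [Fin.prod_univ_eq_prod_range (fun j => 2 * m' - j) (2 * p), ← Nat.descFactorial_eq_prod_range,
    Nat.descFactorial_eq_factorial_mul_choose, Nat.cast_mul, ← mul_assoc, inv_mul_cancel₀ hfac, one_mul]

/-- **The linear part of the RG map in binomial–Gram form, DECAY-WEIGHTED, no prescription** (BGM 2006 (2.61)–(2.63), (2.66), (2.77)–(2.80), §3 (3.2)–(3.8);
the `J = ∅` case of `sum_wt_norm_kernel_gaussConv_sub_le_binomial_prescribed_of_gramBounded`): `H` even, `C` replica-Gram-bounded (`κ ≥ 0`), `wt` a tree weight,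
`N(m′)` the `wt`-weighted pinned sums of `kernel_{2m′} H`; then for `p`, one output leg pinned,
`Σ_{W_i = w} wt(W)·‖kernel_{2p}(e^{Δ_C}H − H)(W)‖ ≤ Σ_{m′ ≤ |Γ|/2, p < m′} C(2m′, 2p)·κ^{2m′−2p}·N(m′)`. [cite: BenfattoGiulianiMastropietro2006, (2.61)-(2.63), (2.66), (3.2)-(3.8)] -/
theorem sum_wt_norm_kernel_gaussConv_sub_sub_laplacian_le_binomial_of_gramBounded_wt (C : Matrix Γ Γ 𝕜) (hwt : IsTreeWeight wt) {κ : ℝ} (hκ : 0 ≤ κ)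
    (hGB : IsGramBoundedR C κ) (H : GrassmannAlgebra 𝕜 Γ) (hH : H ∈ evenPart 𝕜 Γ) {p : ℕ} (N : ℕ → ℝ) (hN0 : ∀ m', 0 ≤ N m')
    (hN : ∀ (m' : ℕ) (t : Fin (2 * m')) (a : Γ), ∑ Y ∈ univ.filter (fun Y : Fin (2 * m') → Γ => Y t = a),
      ‖kernel 𝕜 H (2 * m') Y‖ * wt (univ.image Y) ≤ N m')
    (i : Fin (2 * p)) (w : Γ) :
    ∑ W ∈ univ.filter (fun W : Fin (2 * p) → Γ => W i = w), wt (univ.image W) *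
        ‖kernel 𝕜 (gaussConv 𝕜 C H - H - grassmannLaplacian 𝕜 C H) (2 * p) W‖ ≤
      ∑ m' ∈ range (Fintype.card Γ / 2 + 1), if p + 1 < m' then ((2 * m').choose (2 * p) : ℝ) * κ ^ (2 * m' - 2 * p) * N m' else 0 := by
  have h := sum_wt_norm_kernel_gaussConv_sub_sub_laplacian_le_binomial_prescribed_of_gramBounded C hwt hκ hGB H hH (p := p) ∅ (fun _ _ => true)
    (fun m' _ => N m') (fun m' _ => hN0 m')
    (by
      intro m' T _ ι _ t _ a
      refine le_of_eq_of_le (sum_congr rfl fun Y _ => ?_) (hN m' t a)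
      rw [prod_eq_one fun j _ => by simp, mul_one])
    i (Finset.notMem_empty i) w
  have hfilter : univ.filter (fun W : Fin (2 * p) → Γ => W i = w ∧ ∀ j ∈ (∅ : Finset (Fin (2 * p))), (fun (_ : Fin (2 * p)) (_ : Γ) => true) j (W j) = true) =
      univ.filter (fun W : Fin (2 * p) → Γ => W i = w) := filter_congr fun W _ => by simp
  rw [hfilter] at h
  refine h.trans (le_of_eq (sum_congr rfl fun m' _ => ?_))
  split_ifs with hm
  · rw [filter_true_of_mem fun j _ => Finset.notMem_empty j, card_empty, pow_zero, mul_one, factorial_inv_mul_prod_sub_eq_choose₂]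
  · rfl

end Abstract

/-! ### §1 Generic label sets: read through `(f, g)` (the one-line term pulls back with `grassmannLaplacian_map`) -/

section Generic

variable {𝕜 : Type*} [RCLike 𝕜] {Γ Γ' Γ'' : Type u} {Λ : Type*} [Fintype Γ] [DecidableEq Γ] [Fintype Γ'] [DecidableEq Γ']
  [Fintype Γ''] [DecidableEq Γ''] [DecidableEq Λ] {wt : Finset Λ → ℝ}

/-- **First order of the increment, read through `(f, g)`, binomial–Gram form, DECAY-WEIGHTED** (BGM 2006 (2.61)–(2.63), (2.66) at first order with
(2.70)–(2.71a), §3 (3.2)–(3.8)): `Ṽ` even with `wt∘π′`-weighted pinned sums `≤ N(m′)`, `C′ = fᵀ C f` replica-Gram-bounded (`κ ≥ 0`), weighted costs `(cr, cc)` of the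
matrix of `g ∘ f`; then for every `p ≥ 1`, one output leg pinned at `w″`,
`Σ_{X″_q = w″} wt(π″X″)·‖kernel_{2p} (map g (e^{Δ_C}(map f Ṽ) − map f Ṽ))(X″)‖ ≤ cr·cc^{2p−1}·Σ_{m′ ≤ |Γ′|/2, p < m′} C(2m′,2p) κ^{2m′−2p} N(m′)`.
[cite: BenfattoGiulianiMastropietro2006, (2.61)-(2.63), (2.66), (3.2)-(3.8)] -/
theorem sum_wt_norm_kernel_map_gaussConv_sub_sub_laplacian_le_binomial_of_gramBounded (hwt : IsTreeWeight wt) (π' : Γ' → Λ) (π'' : Γ'' → Λ)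
    (C : Matrix Γ Γ 𝕜) (f : (Γ' → 𝕜) →ₗ[𝕜] (Γ → 𝕜)) (g : (Γ → 𝕜) →ₗ[𝕜] (Γ'' → 𝕜))
    (Vt : GrassmannAlgebra 𝕜 Γ') (hVt : Vt ∈ evenPart 𝕜 Γ')
    {κ : ℝ} (hκ : 0 ≤ κ) (hGB : IsGramBoundedR ((LinearMap.toMatrix' f).transpose * C * LinearMap.toMatrix' f) κ)
    (N : ℕ → ℝ) (hN0 : ∀ m', 0 ≤ N m')
    (hN : ∀ (m' : ℕ) (j : Fin (2 * m')) (w : Γ'), ∑ Y ∈ univ.filter (fun Y : Fin (2 * m') → Γ' => Y j = w),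
      ‖kernel 𝕜 Vt (2 * m') Y‖ * wt ((univ.image Y).image π') ≤ N m')
    {cr cc : ℝ} (hcc0 : 0 ≤ cc)
    (hrow' : ∀ X'', ∑ X', ‖(LinearMap.toMatrix' g * LinearMap.toMatrix' f) X'' X'‖ * wt {π'' X'', π' X'} ≤ cr)
    (hcol' : ∀ X', ∑ X'', ‖(LinearMap.toMatrix' g * LinearMap.toMatrix' f) X'' X'‖ * wt {π'' X'', π' X'} ≤ cc)
    (p : ℕ) (q : Fin (2 * (p + 1))) (w'' : Γ'') :
    ∑ X'' ∈ univ.filter (fun X'' : Fin (2 * (p + 1)) → Γ'' => X'' q = w''), wt ((univ.image X'').image π'') *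
        ‖kernel 𝕜 (ExteriorAlgebra.map g (gaussConv 𝕜 C (ExteriorAlgebra.map f Vt) - ExteriorAlgebra.map f Vt -
          grassmannLaplacian 𝕜 C (ExteriorAlgebra.map f Vt))) (2 * (p + 1)) X''‖ ≤
      cr * cc ^ (2 * p + 1) *
        ∑ m' ∈ range (Fintype.card Γ' / 2 + 1),
          (if p + 1 + 1 < m' then ((2 * m').choose (2 * (p + 1)) : ℝ) * κ ^ (2 * m' - 2 * (p + 1)) * N m' else 0) := by
  set C' : Matrix Γ' Γ' 𝕜 := (LinearMap.toMatrix' f).transpose * C * LinearMap.toMatrix' f with hC'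
  -- the weight pulled back to the auxiliary labels is a tree weight
  set wt' : Finset Γ' → ℝ := fun S => wt (S.image π') with hwt'
  have hwt'tree : IsTreeWeight wt' := hwt.comap π'
  set B : ℝ := ∑ m' ∈ range (Fintype.card Γ' / 2 + 1),
    (if p + 1 + 1 < m' then ((2 * m').choose (2 * (p + 1)) : ℝ) * κ ^ (2 * m' - 2 * (p + 1)) * N m' else 0) with hB
  have hB0 : 0 ≤ B := sum_nonneg fun m' _ => by
    split_ifs
    · exact mul_nonneg (mul_nonneg (Nat.cast_nonneg _) (pow_nonneg hκ _)) (hN0 m')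
    · exact le_rfl
  -- the weighted first-order bound in the auxiliary representation, degree `2(p+1) = (2p+1)+1`
  have haux : ∀ (t : Fin (2 * p + 1 + 1)) (x : Γ'), ∑ X ∈ univ.filter (fun X : Fin (2 * p + 1 + 1) → Γ' => X t = x),
      ‖kernel 𝕜 (gaussConv 𝕜 C' Vt - Vt - grassmannLaplacian 𝕜 C' Vt) (2 * p + 1 + 1) X‖ * wt ((univ.image X).image π') ≤ B := by
    intro t x
    have h := sum_wt_norm_kernel_gaussConv_sub_sub_laplacian_le_binomial_of_gramBounded_wt C' hwt'tree hκ hGB Vt hVt (p := p + 1) N hN0 hN t x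
    refine le_of_eq_of_le (sum_congr rfl fun X _ => mul_comm _ _) ?_
    exact h
  -- read through `g ∘ f` by the weighted Young inequality
  have hsub : gaussConv 𝕜 C (ExteriorAlgebra.map f Vt) - ExteriorAlgebra.map f Vt - grassmannLaplacian 𝕜 C (ExteriorAlgebra.map f Vt) =
      ExteriorAlgebra.map f (gaussConv 𝕜 C' Vt - Vt - grassmannLaplacian 𝕜 C' Vt) := by
    rw [gaussConv_map, grassmannLaplacian_map, map_sub, map_sub]
  show ∑ X'' ∈ univ.filter (fun X'' : Fin (2 * p + 1 + 1) → Γ'' => X'' q = w''), wt ((univ.image X'').image π'') *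
      ‖kernel 𝕜 (ExteriorAlgebra.map g (gaussConv 𝕜 C (ExteriorAlgebra.map f Vt) - ExteriorAlgebra.map f Vt -
        grassmannLaplacian 𝕜 C (ExteriorAlgebra.map f Vt))) (2 * p + 1 + 1) X''‖ ≤
    cr * cc ^ (2 * p + 1) * B
  rw [hsub, map_map_eq_map_comp]
  exact sum_filter_wt_norm_kernel_map_le hwt π' π'' (g ∘ₗ f) hcc0
    (by intro X''; rw [LinearMap.toMatrix'_comp]; exact hrow' X'')
    (by intro X'; simp only [LinearMap.toMatrix'_comp]; exact hcol' X') (gaussConv 𝕜 C' Vt - Vt - grassmannLaplacian 𝕜 C' Vt) (2 * p + 1) hB0 haux q w''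

end Generic

/-! ### §2 The Hubbard torus: plateau transfer in the engine's weighted currency -/

section Transfer

variable {L M : ℕ} [NeZero L] [NeZero M] {N N' : ℕ} {Λ : Type*} [DecidableEq Λ] {wt : Finset Λ → ℝ}

/-- **The FIRST-ORDER increment of the sectorised kernels across one slice, binomial–Gram form, DECAY-WEIGHTED** (BGM 2006 (2.61)–(2.63), (2.66), first order, in the
(2.70)–(2.71a) sector currency with the decay bookkeeping of §3 (3.2)–(3.8)).  Data: a tree weight `wt` on `Finset Λ`, position maps `π` (input sector-field labels),
`π″` (output labels); thin/fat input families `F, F̃` (`F̃F = F`, `ΣF = 0 ⇒ F = 0`), output family `F′`, plateau of `F` over `supp C` and over `F′`; ANY even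
input `G`; the sectorised covariance `S(F̃)ᵀ C S(F̃)` replica-Gram-bounded with constant `κ ≥ 0`; WEIGHTED input sizes in the engine's currency
`Σ_{Y_j = w} wt(πY)·‖kernel (map (toLin' E(F)) G) (2m′) Y‖ ≤ B m′`; weighted overlap costs `(cr, cc)` of `E(F′)S(F̃)`.  Then for every `p ≥ 1`, one output leg pinned,
`Σ_{X″_q = w″} wt(π″X″)·‖kernel (map (toLin' E(F′)) (e^{Δ_C}G − G)) (2p) X″‖ ≤ cr·cc^{2p−1}·Σ_{m′ > p} C(2m′,2p)·κ^{2m′−2p}·(ε_x^{2m′}·B m′)` — only the HIGHER kernels of `G`,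
self-contracted; no row/column sums of the slice; the output weight at most the input's (`IsTreeWeight.mono`: self-contraction does not move positions).
[cite: BenfattoGiulianiMastropietro2006, (2.61)-(2.63), (2.66), (3.2)-(3.8)] -/
theorem sum_wt_norm_sectorAnalysis_gaussConv_sub_sub_laplacian_le_binomial_of_plateau
    (hwt : IsTreeWeight wt) (π : SpaceTimeIdx L M × SectorLeg N → Λ) (π'' : SpaceTimeIdx L M × SectorLeg N' → Λ)
    {β : ℝ} (hβ : 0 < β) (F Ft : Fin N → FreqMomentum L M → ℂ) (hFF : ∀ ω k, Ft ω k * F ω k = F ω k)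
    (hF0 : ∀ k, ∑ ω, F ω k = 0 → ∀ ω, F ω k = 0)
    (F' : Fin N' → FreqMomentum L M → ℂ) (G : HubbardGrassmann L M) (hG : G ∈ evenPart ℂ (HubbardFieldIdx L M))
    (C : Matrix (HubbardFieldIdx L M) (HubbardFieldIdx L M) ℂ)
    (hCpl : ∀ X Y, C X Y ≠ 0 → ∑ ω, F ω X.1.1 = 1 ∧ ∑ ω, F ω Y.1.1 = 1)
    (hF'pl : ∀ (ω' : Fin N') (k : FreqMomentum L M), F' ω' k ≠ 0 → ∑ ω, F ω k = 1)
    {κ : ℝ} (hκ : 0 ≤ κ)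
    (hGB : IsGramBoundedR ((sectorSubMatrix L M β Ft).transpose * C * sectorSubMatrix L M β Ft) κ)
    (B : ℕ → ℝ) (hB0 : ∀ m', 0 ≤ B m')
    (hB : ∀ (m' : ℕ) (j : Fin (2 * m')) (w : SpaceTimeIdx L M × SectorLeg N),
      ∑ Y ∈ univ.filter (fun Y : Fin (2 * m') → SpaceTimeIdx L M × SectorLeg N => Y j = w),
        wt ((univ.image Y).image π) * ‖kernel ℂ (ExteriorAlgebra.map (Matrix.toLin' (sectorAnalysisMatrix L M β F)) G) (2 * m') Y‖ ≤
          B m')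
    {cr cc : ℝ} (hcc0 : 0 ≤ cc)
    (hrow' : ∀ X'', ∑ X', ‖(sectorAnalysisMatrix L M β F' * sectorSubMatrix L M β Ft) X'' X'‖ * wt {π'' X'', π X'} ≤ cr)
    (hcol' : ∀ X', ∑ X'', ‖(sectorAnalysisMatrix L M β F' * sectorSubMatrix L M β Ft) X'' X'‖ * wt {π'' X'', π X'} ≤ cc)
    (p : ℕ) (q : Fin (2 * (p + 1))) (w'' : SpaceTimeIdx L M × SectorLeg N') :
    ∑ X'' ∈ univ.filter (fun X'' : Fin (2 * (p + 1)) → SpaceTimeIdx L M × SectorLeg N' => X'' q = w''),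
        wt ((univ.image X'').image π'') *
          ‖kernel ℂ (ExteriorAlgebra.map (Matrix.toLin' (sectorAnalysisMatrix L M β F')) (gaussConv ℂ C G - G - grassmannLaplacian ℂ C G))
            (2 * (p + 1)) X''‖ ≤
      cr * cc ^ (2 * p + 1) *
        ∑ m' ∈ range (Fintype.card (SpaceTimeIdx L M × SectorLeg N) / 2 + 1),
          (if p + 1 + 1 < m' then ((2 * m').choose (2 * (p + 1)) : ℝ) * κ ^ (2 * m' - 2 * (p + 1)) *
            (imagTimeWeight β M ^ (2 * m') * B m') else 0) := by
  have hε : 0 ≤ imagTimeWeight β M := imagTimeWeight_nonneg hβ.le M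
  -- the weighted pinned sums of the preimage's kernels, in the engine's currency
  have hwl : ∀ S : Finset (SpaceTimeIdx L M × SectorLeg N), 0 ≤ wt (S.image π) := fun S => zero_le_one.trans (hwt.one_le _)
  have hN : ∀ (m' : ℕ) (j : Fin (2 * m')) (w : SpaceTimeIdx L M × SectorLeg N),
      ∑ Y ∈ univ.filter (fun Y : Fin (2 * m') → SpaceTimeIdx L M × SectorLeg N => Y j = w),
        ‖kernel ℂ (sectorPreimage β F G) (2 * m') Y‖ * wt ((univ.image Y).image π) ≤ imagTimeWeight β M ^ (2 * m') * B m' :=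
    fun m' j w => sum_wt_norm_kernel_sectorPreimage_le hβ.le F G (fun S => wt (S.image π)) hwl (hB0 m') (hB m') j w
  have hN0 : ∀ m', 0 ≤ imagTimeWeight β M ^ (2 * m') * B m' := fun m' => mul_nonneg (pow_nonneg hε _) (hB0 m')
  -- transfer from `map S Ṽ` to `G` (plateau identities)
  have hid := map_sectorAnalysis_map_sectorPreimage_of_plateau hβ.ne' F Ft hFF hF0 F' G hF'pl
  have hgc := map_sectorAnalysis_gaussConv_map_sectorPreimage_of_plateau hβ.ne' F Ft hFF hF0 F' G C hCpl hF'pl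
  have hgl := map_sectorAnalysis_grassmannLaplacian_map_sectorPreimage_of_plateau hβ.ne' F Ft hFF hF0 F' G C hCpl hF'pl
  have hrepl : ExteriorAlgebra.map (Matrix.toLin' (sectorAnalysisMatrix L M β F')) (gaussConv ℂ C G - G - grassmannLaplacian ℂ C G) =
      ExteriorAlgebra.map (Matrix.toLin' (sectorAnalysisMatrix L M β F'))
        (gaussConv ℂ C (ExteriorAlgebra.map (Matrix.toLin' (sectorSubMatrix L M β Ft)) (sectorPreimage β F G)) -
          ExteriorAlgebra.map (Matrix.toLin' (sectorSubMatrix L M β Ft)) (sectorPreimage β F G) -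
          grassmannLaplacian ℂ C (ExteriorAlgebra.map (Matrix.toLin' (sectorSubMatrix L M β Ft)) (sectorPreimage β F G))) := by
    rw [map_sub, map_sub, map_sub, map_sub, hid, hgc, hgl]
  rw [hrepl]
  exact sum_wt_norm_kernel_map_gaussConv_sub_sub_laplacian_le_binomial_of_gramBounded hwt π π'' C (Matrix.toLin' (sectorSubMatrix L M β Ft))
    (Matrix.toLin' (sectorAnalysisMatrix L M β F')) (sectorPreimage β F G) (sectorPreimage_mem_evenPart β F hG) hκ
    (by simpa only [LinearMap.toMatrix'_toLin'] using hGB) (fun m' => imagTimeWeight β M ^ (2 * m') * B m') hN0 hN hcc0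
    (by simpa only [LinearMap.toMatrix'_toLin'] using hrow') (by simpa only [LinearMap.toMatrix'_toLin'] using hcol') p q w''

end Transfer

end Literature.MathematicalPhysics.QuantumLattice

end
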